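import Literature.AnabelianGeometry.AbsoluteAnabelian.AbsTopIChainsCuspidalAlgorithmExists
import Literature.AnabelianGeometry.AbsoluteAnabelian.AbsTopIChainsCuspidalFacts
import Literature.AnabelianGeometry.SemiGraphs.ProSigmaSurfaceCuspTransvection
import Literature.AnabelianGeometry.SemiGraphs.ProSigmaCuspInertiaMalnormalHolds
import Literature.AnabelianGeometry.SemiGraphs.ProSigmaCompletionModels
import HarnessLib

/-!
# [AbsTopI] Lemma 4.5 (v)/(vi) at the SPLIT extension `G × Δ` over a GENUINE pro-`Σ` surface group
# `Δ`: (vi) `D_x = C_Π(D_x ∩ Δ)` HOLDS, (v) "the cusps are recovered" FAILS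

S. Mochizuki, *Topics in Absolute Anabelian Geometry I* [AbsTopI], Lemma 4.5 (v) p. 55 ("by
allowing `H` to vary, this yields a ["group-theoretic"] characterization of the decomposition groups
of cusps in `Π`") and (vi) p. 55 ("Let `I ⊆ Π` be a decomposition group of a cusp. Then
`I = C_Π(I ∩ Δ)`"); [AbsAnab] Lemma 1.3.7 p. 18 (`I_x ⊆ Δ_X` commensurably terminal); [AbsTopIII]
Thm 1.11 (b) p. 46 (`D_x` = the normaliser of `I_x`).  abc-iut cell, FACT-LIST rows F-0206
`CuspidalAlgorithm.RecoversCusps`, F-0207 `CuspidalData.DecompEqCommensuratorOfInertia` (trunk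
`AbsTopIChains.lean`, tranche abc-iut-f-060), F-0003 `InertiaCommensurablyTerminal`, F-0405
`DecompEqNormalizer`; D-0079 L-F [AbsTop*]+[AbsAnab] table `plan/L4/LF-ABSTOP.tsv` (T2 rows: "the
instance at GENUINE data").

PROOF-ONLY file (no `def` / `instance` / `structure`).  THE DATUM
(`CuspidalData.exists_split_surfaceGroup_model`): for a profinite group `G`, a nonempty set of primes
`Σ` and a hyperbolic type `(g, r)`, let `ι : Γ_{g,r} → Δ` be a pro-`Σ` completion of the punctured
surface group ([SemiAnbd] Ex 2.10; `IsProSigmaCompletion.exists_isProSigmaCompletion`), `Π := G × Δ ↠ G`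
the SPLIT extension (first projection; `G` acts trivially on `Δ`), and mark ALL `r` cusps:
`I_j := 1 × closure ι⟨c_j⟩`, `D_j := G × closure ι⟨c_j⟩` (closed; pairwise non-conjugate by the
malnormality theorem `proSigmaCuspInertiaMalnormal_holds` — so this IS a `CuspidalData`).  THEN:

* (vi) **F-0207 HOLDS** (`DecompEqCommensuratorOfInertia`), hence F-0003 and F-0405 hold
  (abc-iut-f-060's structure theorem `decompEqCommensuratorOfInertia_iff`): the commensurator of
  `1 × Ī` in `G × Δ` is `G × C_Δ(Ī)` (`commensurator_bot_prod`, elementary) and `C_Δ(Ī) = Ī`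
  ([SemiAnbd] Ex 2.10 / Rmk 2.10.1, PROVED in the tree: `cuspInertia_closure_isCommensurablyTerminal`)
  — an upgrade of the lineage's one-cusp `F̂₂` product model (p434624) to the genuine geometric
  fundamental group of type `(g, r)` with ALL its cusps, any `Σ`;
* (v) **F-0206 FAILS whenever some continuous automorphism of `Δ` moves a cusp class** (last
  conjunct): by abc-iut-f-060's criterion `CuspidalAlgorithm.exists_recoversCusps_iff`, `id_G × ê`
  is a `Δ`-preserving automorphism of `Π` moving `D_{x₀}` off every cuspidal class; and such `ê` EXISTS
  for `r ≥ 2` (`exists_continuousMulEquiv_map_cuspInertia_not_conj`, the transvection `c₁ ↦ c₁ s²`,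
  `ProSigmaSurfaceCuspTransvection.lean`): `exists_split_surfaceGroup_model_not_recoversCusps`,
  `exists_split_tripod_not_recoversCusps`.

So at genuine GEOMETRIC data the cusps are NOT determined by the pair `Δ ⊴ Π` when the arithmetic
action is trivial: Lemma 4.5 (v) rests on (iii) (weights of the Galois action, [CombGC] §2) — the
TIGHTNESS of row F-0206, which therefore has no "instance at genuine data" short of an extension
carrying a non-trivial outer Galois action with the weight property.  HONEST FRAMING: classical
profinite group theory of surface groups; a split product is not the étale `π₁` of a curve over a
number field or MLF; instance / counter-instance information for assumption labels on OUR typed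
statements; nothing here bears on [IUTchIII] Cor 3.12; no abc claim.
-/

noncomputable section

open scoped Pointwise

namespace Literature.AnabelianGeometry.AbsoluteAnabelian.FundamentalExtension

open Literature.AnabelianGeometry.SemiGraphs
open Literature.AnabelianGeometry.SemiGraphs.SemiGraphOfAnabelioids
open Literature.GroupTheory.CombinatorialGroupTheory

/-! ## §1. Subgroups `H × A` of a product `G × Q` -/

section Prod

variable {G Q : Type*} [Group G] [Group Q]

/-- `1 × A` is the image of `A` under the right inclusion. [folklore] -/
private theorem bot_prod_eq_map_inr (A : Subgroup Q) :
    (⊥ : Subgroup G).prod A = A.map (MonoidHom.inr G Q) := by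
  ext ⟨a, q⟩
  simp only [Subgroup.mem_prod, Subgroup.mem_bot, Subgroup.mem_map, MonoidHom.inr_apply,
    Prod.mk.injEq]
  constructor
  · rintro ⟨rfl, hq⟩
    exact ⟨q, hq, rfl, rfl⟩
  · rintro ⟨q', hq', h1, rfl⟩
    exact ⟨h1.symm, hq'⟩

/-- Conjugating `H × A` by `(a, q)` conjugates the factors. [folklore] -/
private theorem toConjAct_prod_smul_prod (a : G) (q : Q) (H : Subgroup G) (A : Subgroup Q) :
    ConjAct.toConjAct (a, q) • H.prod A =
      (ConjAct.toConjAct a • H).prod (ConjAct.toConjAct q • A) := by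
  ext ⟨x, y⟩
  rw [Subgroup.mem_prod, Subgroup.mem_smul_pointwise_iff_exists, Subgroup.mem_smul_pointwise_iff_exists,
    Subgroup.mem_smul_pointwise_iff_exists]
  simp only [ConjAct.smul_def, ConjAct.ofConjAct_toConjAct, Prod.exists, Subgroup.mem_prod, Prod.inv_mk,
    Prod.mk_mul_mk, Prod.mk.injEq]
  constructor
  · rintro ⟨s, t, ⟨hs, ht⟩, hx, hy⟩
    exact ⟨⟨s, hs, hx⟩, ⟨t, ht, hy⟩⟩
  · rintro ⟨⟨s, hs, hx⟩, ⟨t, ht, hy⟩⟩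
    exact ⟨s, t, ⟨hs, ht⟩, hx, hy⟩

/-- `MulAut.conj h • S` (the cuspidal-data convention) is `ConjAct.toConjAct h • S` (layer L3's
convention). [folklore] -/
private theorem conj_smul_eq_toConjAct_smul' {K : Type*} [Group K] (h : K) (S : Subgroup K) :
    MulAut.conj h • S = ConjAct.toConjAct h • S := by
  ext x
  simp only [Subgroup.mem_smul_pointwise_iff_exists, ConjAct.smul_def, ConjAct.ofConjAct_toConjAct,
    MulAut.smul_def, MulAut.conj_apply]

/-- `1 × A` and `1 × B` are commensurable iff `A` and `B` are. [folklore] -/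
private theorem commensurable_bot_prod_iff (A B : Subgroup Q) :
    Subgroup.Commensurable ((⊥ : Subgroup G).prod A) ((⊥ : Subgroup G).prod B) ↔
      Subgroup.Commensurable A B := by
  have hinj : Function.Injective (MonoidHom.inr G Q) := fun x y h => (Prod.ext_iff.mp h).2
  simp only [Subgroup.Commensurable, bot_prod_eq_map_inr,
    Subgroup.relIndex_map_map_of_injective _ _ hinj]

/-- **The commensurator of `1 × A` in `G × Q` is `G × C_Q(A)`.** [folklore] -/
private theorem commensurator_bot_prod (A : Subgroup Q) :
    Subgroup.Commensurable.commensurator ((⊥ : Subgroup G).prod A) =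
      (⊤ : Subgroup G).prod (Subgroup.Commensurable.commensurator A) := by
  ext ⟨a, q⟩
  rw [Subgroup.Commensurable.commensurator_mem_iff, Subgroup.mem_prod,
    Subgroup.Commensurable.commensurator_mem_iff, toConjAct_prod_smul_prod, Subgroup.smul_bot,
    commensurable_bot_prod_iff]
  simp only [Subgroup.mem_top, true_and]

/-- Two subgroups `H × A = G × B` of a product have equal second factors. [folklore] -/
private theorem eq_of_prod_eq_top_prod {H : Subgroup G} {A B : Subgroup Q}
    (h : H.prod A = (⊤ : Subgroup G).prod B) : A = B := by
  ext y
  have := SetLike.ext_iff.mp h ((1 : G), y)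
  simpa [Subgroup.mem_prod] using this

end Prod

/-! ## §2. The split datum `G × Δ` over a genuine pro-`Σ` surface group -/

/-- **[AbsTopI] Lemma 4.5 (vi) HOLDS — and (v) fails as soon as `Aut(Δ)` moves a cusp class — at the
split extension over a genuine pro-`Σ` surface group.**  For every profinite `G`, nonempty set of
primes `Σ` and hyperbolic `(g, r)` there are a pro-`Σ` completion `ι : Γ_{g,r} → Δ` (`Δ` profinite),
the SPLIT extension `E = (Π := G × Δ ↠ G)` (`E.gal = G`, `E.arith = G × Δ`, augmentation the first
projection, so `Δ_E = 1 × Δ`) and cuspidal data `C` with cusps `Fin r` (`j`), inertia groups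
`I_x = 1 × closure ι⟨c_{j x}⟩` (topologically isomorphic to the genuine closed cusp inertia groups) and
`D_x = G × closure ι⟨c_{j x}⟩`, such that `C.DecompEqCommensuratorOfInertia` (F-0207, (vi)),
`C.InertiaCommensurablyTerminal` (F-0003, [AbsAnab] Lem 1.3.7) and `C.DecompEqNormalizer` (F-0405,
[AbsTopIII] Thm 1.11 (b)) HOLD, while for every cusp `x₀` and every continuous automorphism `ê` of
`Δ` carrying `closure ι⟨c_{j x₀}⟩` onto NO `Δ`-conjugate of any `closure ι⟨c_y⟩`, NO group-theoretic
cuspidal algorithm recovers the cusps of `(E, C)` (F-0206, (v): `¬ ∃ A, A.RecoversCusps E C`).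
[cite: MochizukiAbsTopI2012, Lemma 4.5 (v)(vi) p.55] [cite: MochizukiAbsAnab2004, Lemma 1.3.7 p.18]
[cite: MochizukiSemiAnbd2006, Ex. 2.10 p.31] -/
theorem CuspidalData.exists_split_surfaceGroup_model (G : ProfiniteGrp.{0}) {Sigma : Set ℕ}
    (hne : Sigma.Nonempty) (hprime : ∀ p ∈ Sigma, p.Prime) (g r : ℕ)
    (hgr : PuncturedSurfaceGroup.IsHyperbolicType g r) :
    ∃ (Q : ProfiniteGrp.{0}) (ι : PuncturedSurfaceGroup g r →* Q) (E : FundamentalExtension.{0})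
      (C : CuspidalData E) (j : C.Cusp ≃ Fin r),
      IsProSigmaCompletion Sigma ι ∧ E.gal = G ∧ E.arith = ProfiniteGrp.of (G × Q) ∧
      (∀ x, Nonempty (↥(C.Icusp x) ≃ₜ*
        ↥((PuncturedSurfaceGroup.cuspInertia (g := g) (j x)).map ι).topologicalClosure)) ∧
      C.DecompEqCommensuratorOfInertia ∧ C.InertiaCommensurablyTerminal ∧ C.DecompEqNormalizer ∧
      (∀ x₀ : C.Cusp,
        (∃ e : Q ≃ₜ* Q, ∀ (y : Fin r) (q : Q),
          ((PuncturedSurfaceGroup.cuspInertia (g := g) (j x₀)).map ι).topologicalClosure.map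
              e.toMulEquiv.toMonoidHom ≠
            ConjAct.toConjAct q •
              ((PuncturedSurfaceGroup.cuspInertia (g := g) y).map ι).topologicalClosure) →
        ¬ ∃ A : CuspidalAlgorithm.{0}, A.RecoversCusps E C) := by
  classical
  obtain ⟨Q, ι, hι⟩ :=
    IsProSigmaCompletion.exists_isProSigmaCompletion (PuncturedSurfaceGroup g r) Sigma
  -- the genuine closed cusp inertia groups `Ī_i = closure ι⟨c_i⟩ ⊆ Δ`
  let Ī : Fin r → Subgroup Q := fun i =>
    ((PuncturedSurfaceGroup.cuspInertia (g := g) i).map ι).topologicalClosure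
  have hmal := fun i i' => proSigmaCuspInertiaMalnormal_holds Sigma hne hprime g r hgr Q ι hι i i'
  have hCT : ∀ i, Subgroup.Commensurable.commensurator (Ī i) = Ī i := fun i =>
    (cuspInertia_closure_isCommensurablyTerminal hne hprime hgr ι hι i).commensurator_eq
  -- the split extension `Π := G × Δ ↠ G`
  let E : FundamentalExtension.{0} :=
    { arith := ProfiniteGrp.of (G × Q)
      gal := G
      aug := ContinuousMonoidHom.fst G Q
      aug_surjective := fun a => ⟨(a, 1), rfl⟩ }
  have hmem : ∀ x : G × Q, x ∈ E.geom ↔ x.1 = 1 := fun x => E.mem_geom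
  have hgeom : E.geom = ((⊥ : Subgroup G).prod ⊤ : Subgroup (G × Q)) := by
    ext x
    rw [hmem, Subgroup.mem_prod]
    simp only [Subgroup.mem_bot, Subgroup.mem_top, and_true]
  -- decomposition and inertia groups of the marked cusps
  let D : Fin r → Subgroup (G × Q) := fun i => (⊤ : Subgroup G).prod (Ī i)
  let I : Fin r → Subgroup (G × Q) := fun i => (⊥ : Subgroup G).prod (Ī i)
  have hID : ∀ i, I i = D i ⊓ ((⊥ : Subgroup G).prod ⊤ : Subgroup (G × Q)) := fun i => by
    ext ⟨a, q⟩
    simp only [I, D, Subgroup.mem_inf, Subgroup.mem_prod, Subgroup.mem_bot, Subgroup.mem_top, true_and,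
      and_true]
    exact and_comm
  have hDclosed : ∀ i, IsClosed ((D i : Subgroup (G × Q)) : Set (G × Q)) := fun i => by
    have : ((D i : Subgroup (G × Q)) : Set (G × Q)) = Set.univ ×ˢ (Ī i : Set Q) := by
      ext ⟨a, q⟩
      simp [D, Subgroup.mem_prod]
    rw [this]
    exact isClosed_univ.prod (Subgroup.isClosed_topologicalClosure _)
  have hconj : ∀ (i : Fin r) (a : G) (q : Q), MulAut.conj ((a, q) : G × Q) • D i =
      (ConjAct.toConjAct a • (⊤ : Subgroup G)).prod (ConjAct.toConjAct q • Ī i) := fun i a q => by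
    rw [conj_smul_eq_toConjAct_smul', toConjAct_prod_smul_prod]
  have hcomm : ∀ i, Subgroup.Commensurable.commensurator (I i) = D i := fun i => by
    change Subgroup.Commensurable.commensurator ((⊥ : Subgroup G).prod (Ī i)) =
      (⊤ : Subgroup G).prod (Ī i)
    rw [commensurator_bot_prod, hCT]
  -- the cuspidal data: all `r` cusps
  let C : CuspidalData E :=
    { Cusp := Fin r
      Dcusp := fun i => D i
      Icusp := fun i => I i
      Icusp_eq := fun i => by rw [hgeom]; exact hID i
      isClosed_Dcusp := fun i => hDclosed i
      eq_of_conj := fun x y gq h => by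
        obtain ⟨a, q⟩ := gq
        have h' : MulAut.conj ((a, q) : G × Q) • D x = D y := h
        rw [hconj] at h'
        have hq : ConjAct.toConjAct q • Ī x = Ī y := eq_of_prod_eq_top_prod h'
        by_contra hxy
        have hbot : Ī y ⊓ ConjAct.toConjAct q • Ī x = ⊥ := (hmal y x).2 q (Or.inl (Ne.symm hxy))
        rw [hq, inf_idem] at hbot
        have hinf : (Ī y : Set Q).Infinite := Set.infinite_coe_iff.mp (hmal y x).1
        rw [hbot, Subgroup.coe_bot] at hinf
        exact hinf (Set.finite_singleton 1) }
  -- (vi) and its two halves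
  have hvi : C.DecompEqCommensuratorOfInertia := by
    intro x
    rw [← C.Icusp_eq x]
    exact (hcomm x).symm
  obtain ⟨h137, h111⟩ := C.decompEqCommensuratorOfInertia_iff.mp hvi
  -- the inertia groups are (isomorphic to) the genuine closed cusp inertia groups
  have hiso : ∀ i : Fin r, Nonempty (↥(I i) ≃ₜ* ↥(Ī i)) := fun i =>
    ⟨{ toFun := fun z => ⟨(z : G × Q).2, (Subgroup.mem_prod.mp z.2).2⟩
       invFun := fun w => ⟨((1 : G), (w : Q)), Subgroup.mem_prod.mpr ⟨(⊥ : Subgroup G).one_mem, w.2⟩⟩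
       left_inv := fun z =>
         Subtype.ext (Prod.ext ((Subgroup.mem_bot.mp (Subgroup.mem_prod.mp z.2).1).symm) rfl)
       right_inv := fun w => rfl
       map_mul' := fun _ _ => rfl
       continuous_toFun := (continuous_snd.comp continuous_subtype_val).subtype_mk _
       continuous_invFun := (continuous_const.prodMk continuous_subtype_val).subtype_mk _ }⟩
  refine ⟨Q, ι, E, C, Equiv.refl _, hι, rfl, rfl, fun x => hiso x, hvi, h137, h111, ?_⟩
  -- (v) FAILS as soon as an automorphism of `Δ` moves the class of a cusp inertia group
  rintro x₀ ⟨e, he⟩ ⟨A, hA⟩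
  -- `α := id × ê`, a `Δ`-preserving automorphism of `Π = G × Δ`
  let α : E.arith ≃ₜ* E.arith :=
    { toFun := fun p : G × Q => ((p.1, e p.2) : G × Q)
      invFun := fun p : G × Q => ((p.1, e.symm p.2) : G × Q)
      left_inv := fun p => Prod.ext rfl (e.symm_apply_apply _)
      right_inv := fun p => Prod.ext rfl (e.apply_symm_apply _)
      map_mul' := fun p p' => Prod.ext rfl (map_mul e _ _)
      continuous_toFun := continuous_fst.prodMk (e.continuous.comp continuous_snd)
      continuous_invFun := continuous_fst.prodMk (e.symm.continuous.comp continuous_snd) }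
  have hαapply : ∀ p : G × Q, α.toMulEquiv.toMonoidHom p = ((p.1, e p.2) : G × Q) := fun _ => rfl
  have hα : E.geom.map α.toMulEquiv.toMonoidHom = E.geom := by
    rw [hgeom]
    ext ⟨a, q⟩
    rw [Subgroup.mem_map]
    constructor
    · rintro ⟨z, hz, h⟩
      rw [hαapply] at h
      have h1 : (z : G × Q).1 = a := (Prod.ext_iff.mp h).1
      exact Subgroup.mem_prod.mpr ⟨by rw [← h1]; exact (Subgroup.mem_prod.mp hz).1, Subgroup.mem_top _⟩
    · intro haq
      refine ⟨((1 : G), e.symm q),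
        Subgroup.mem_prod.mpr ⟨(⊥ : Subgroup G).one_mem, Subgroup.mem_top _⟩, ?_⟩
      rw [hαapply]
      exact Prod.ext (Subgroup.mem_bot.mp (Subgroup.mem_prod.mp haq).1).symm (e.apply_symm_apply q)
  obtain ⟨y, gq, hy⟩ := (CuspidalAlgorithm.exists_recoversCusps_iff E C).mp ⟨A, hA⟩ α hα x₀
  obtain ⟨a', q'⟩ := gq
  -- `α(D_{x₀}) = G × ê(Ī_{x₀})`
  have hL : (C.Dcusp x₀).map α.toMulEquiv.toMonoidHom =
      ((⊤ : Subgroup G).prod ((Ī x₀).map e.toMulEquiv.toMonoidHom) : Subgroup (G × Q)) := by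
    ext ⟨a, q⟩
    rw [Subgroup.mem_map]
    constructor
    · rintro ⟨z, hz, h⟩
      rw [hαapply] at h
      have h2 : e (z : G × Q).2 = q := (Prod.ext_iff.mp h).2
      exact Subgroup.mem_prod.mpr
        ⟨Subgroup.mem_top _, ⟨(z : G × Q).2, (Subgroup.mem_prod.mp hz).2, h2⟩⟩
    · intro haq
      obtain ⟨q₁, hq₁, hq⟩ := (Subgroup.mem_prod.mp haq).2
      refine ⟨((a, q₁) : G × Q), Subgroup.mem_prod.mpr ⟨Subgroup.mem_top _, hq₁⟩, ?_⟩
      rw [hαapply]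
      exact Prod.ext rfl hq
  have key : ((⊤ : Subgroup G).prod ((Ī x₀).map e.toMulEquiv.toMonoidHom) : Subgroup (G × Q)) =
      (ConjAct.toConjAct a' • (⊤ : Subgroup G)).prod (ConjAct.toConjAct q' • Ī y) :=
    hL.symm.trans (hy.trans (hconj y a' q'))
  exact he y q' (eq_of_prod_eq_top_prod key.symm).symm

/-- **F-0206 is FALSE at genuine geometric data with trivial arithmetic action (`r ≥ 2`), while
F-0207 / F-0003 / F-0405 hold there.**  For every profinite `G`, nonempty set of primes `Σ` and
hyperbolic type `(g, r)` with `r ≥ 2`: at the split extension `G × Δ` over a pro-`Σ` completion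
`Δ` of `Γ_{g,r}` with all `r` cusps marked (`exists_split_surfaceGroup_model`), (vi) holds and NO
functorial group-theoretic cuspidal algorithm recovers the cusps — the automorphism of `Δ` extending the
transvection `c₁ ↦ c₁ s²` (`exists_continuousMulEquiv_map_cuspInertia_not_conj`) moves a cusp class.
[AbsTopI] Lemma 4.5 (v) needs its arithmetic input (iii).
[cite: MochizukiAbsTopI2012, Lemma 4.5 (v)(vi) p.55] [cite: MochizukiSemiAnbd2006, Ex. 2.10 p.31] -/
theorem CuspidalData.exists_split_surfaceGroup_model_not_recoversCusps (G : ProfiniteGrp.{0})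
    {Sigma : Set ℕ} (hne : Sigma.Nonempty) (hprime : ∀ p ∈ Sigma, p.Prime) (g r : ℕ)
    (hgr : PuncturedSurfaceGroup.IsHyperbolicType g (r + 2)) :
    ∃ (Q : ProfiniteGrp.{0}) (ι : PuncturedSurfaceGroup g (r + 2) →* Q) (E : FundamentalExtension.{0})
      (C : CuspidalData E) (j : C.Cusp ≃ Fin (r + 2)),
      IsProSigmaCompletion Sigma ι ∧ E.gal = G ∧ E.arith = ProfiniteGrp.of (G × Q) ∧
      (∀ x, Nonempty (↥(C.Icusp x) ≃ₜ*
        ↥((PuncturedSurfaceGroup.cuspInertia (g := g) (j x)).map ι).topologicalClosure)) ∧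
      C.DecompEqCommensuratorOfInertia ∧ C.InertiaCommensurablyTerminal ∧ C.DecompEqNormalizer ∧
      ¬ ∃ A : CuspidalAlgorithm.{0}, A.RecoversCusps E C := by
  obtain ⟨Q, ι, E, C, j, hι, hG, hPi, hI, hvi, h137, h111, hneg⟩ :=
    CuspidalData.exists_split_surfaceGroup_model G hne hprime g (r + 2) hgr
  refine ⟨Q, ι, E, C, j, hι, hG, hPi, hI, hvi, h137, h111, hneg (j.symm 1) ?_⟩
  obtain ⟨e, he⟩ := IsProSigmaCompletion.exists_continuousMulEquiv_map_cuspInertia_not_conj hne hprime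
    hgr ι hι
  refine ⟨e, fun y q => ?_⟩
  rw [Equiv.apply_symm_apply]
  exact he y q

/-- **The tripod.**  For every profinite `G` and prime `l`: at `Π = G × Δ`, `Δ` a pro-`l` completion of
`Γ_{0,3} = π₁(P¹ ∖ {0,1,∞})` with its three cusps marked, [AbsTopI] Lemma 4.5 (vi) HOLDS and (v) FAILS
(no group-theoretic cuspidal algorithm recovers the cusps).
[cite: MochizukiAbsTopI2012, Lemma 4.5 (v)(vi) p.55] -/
theorem CuspidalData.exists_split_tripod_not_recoversCusps (G : ProfiniteGrp.{0}) (l : ℕ)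
    (hl : l.Prime) :
    ∃ (E : FundamentalExtension.{0}) (C : CuspidalData E), E.gal = G ∧ Nonempty (C.Cusp ≃ Fin 3) ∧
      C.DecompEqCommensuratorOfInertia ∧ ¬ ∃ A : CuspidalAlgorithm.{0}, A.RecoversCusps E C := by
  obtain ⟨-, -, E, C, j, -, hG, -, -, hvi, -, -, hneg⟩ :=
    CuspidalData.exists_split_surfaceGroup_model_not_recoversCusps G (Sigma := {l})
      (Set.singleton_nonempty l) (fun p hp => by rw [Set.mem_singleton_iff.mp hp]; exact hl) 0 1
      (by unfold PuncturedSurfaceGroup.IsHyperbolicType; norm_num)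
  exact ⟨E, C, hG, ⟨j⟩, hvi, hneg⟩

end Literature.AnabelianGeometry.AbsoluteAnabelian.FundamentalExtension

end
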